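import Summits.QuantumFields.YangMills.Theorems.LuscherReductionTwistedTraceScalingBOStiffCentralData
import Summits.QuantumFields.YangMills.Theorems.LuscherReductionTwistedTraceScalingBOStiffCoreData
import HarnessLib

/-!
# (B-ST) (W1-10a) `…BOStiffQuasimodeFrame`: spec (A) = `spec_S3` (hup + L²(1/w) defect at the profile's OWN Rayleigh level `cΛ`) FOLLOWS from a two-sided model quasimode (Q±) + a thin ring
# (lane A of S-BASE, crux `TwistedTraceScaling` stmt-QuantumFields-20203, C4-CORE, the (B-ST) pen; HANDOFF-g21 UPDATE 21:01Z (W1-10) = (A))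

Abstract frame (§1, any finite measure space, kernel `M ≥ 0`, profile `Θ ≥ 0` vanishing off `S`, weight `w ≥ 0`, `MΘ(x) = ∫ M(x,y)Θ(y)`, `Λ = ∫Θ·MΘ / ∫Θ²w`): if for some level `λ > 0`,
rate `0 ≤ σ ≤ 1/4` and inner set `I ⊆ S`
  (Q+) `MΘ ≤ (1+σ)λ·Θw` on `S`,   (Q−) `(1−σ)λ·Θw ≤ MΘ` on `I`,   (ring) `∫_{S∖I} Θ²w ≤ σ·∫Θ²w`,
then ★ `rayleigh_two_sided` — `(1−σ)²λ ≤ Λ ≤ (1+σ)λ`; ★★ `hup_of_model` — `MΘ ≤ ((1+σ)/(1−σ)²)·Λ·Θw` on `S`; ★★ `hdef_of_model` —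
`∫_S (MΘ − ΛΘw)²/w ≤ ((9σ²+2σ)/(1−σ)⁴)·Λ²·∫Θ²w`.  §2 ★★★ `spec_S3_of_model` — for the record objects `cM, cΘ, cW, cS, cΛ` of ✓`…BOStiffDefs`: if for every `σ > 0`, eventually in `β`,
some `λ(β) > 0` and measurable `I ⊆ cS β` satisfy (Q±), (ring), then the conclusion of `spec_S3` holds (∀ η, η₂ > 0 eventually) — so (A) is reduced to the MODEL ATOM (Q±)+(ring).
HONEST FRAMING: bookkeeping for a stub of a child of the CONDITIONAL route R2b1; the atom (Q±) is OPEN; (B-ST), C4-CORE OPEN; not infinite volume, not a gap, not Clay.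
-/

set_option autoImplicit false

noncomputable section

open MeasureTheory Filter Topology Real
open scoped BigOperators
open Literature.MathematicalPhysics.QuantumFieldTheory
open Literature.MathematicalPhysics.QuantumLattice

namespace Summit.QuantumFields.YangMills.Theorems.FemtoTransferGap.TwoLattice.ConstTube

open Summit.QuantumFields.YangMills.Theorems.FemtoTransferGap
open Summit.QuantumFields.YangMills.Theorems.FemtoTransferGap.TwoLattice
open Summit.QuantumFields.YangMills.Theorems.FemtoTransferGap.TwoLattice.Avg
open Summit.QuantumFields.YangMills.Theorems.FemtoTransferGap.TwoLattice.Stiff (LinkSpace)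

variable {L : ℕ} [NeZero L]

/-! ## §1 The abstract frame -/

section Frame

variable {X : Type*} [MeasurableSpace X] {μ : Measure X} [IsFiniteMeasure μ]
variable {M : X → X → ℝ} {Θ w : X → ℝ} {S I : Set X} {CM CΘ Cw lam σ : ℝ}

omit [NeZero L] in
/-- `x ↦ ∫ M(x,y)Θ(y)` is measurable and bounded. [folklore] -/
theorem kernelProfile_props (hM : Measurable (Function.uncurry M)) (hMb : ∀ x y, |M x y| ≤ CM) (hΘ : Measurable Θ) (hΘb : ∀ x, |Θ x| ≤ CΘ) :
    Measurable (fun x => ∫ y, M x y * Θ y ∂μ) ∧ ∀ x, |∫ y, M x y * Θ y ∂μ| ≤ CM * CΘ * μ.real Set.univ := by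
  have hJ : Measurable fun p : X × X => M p.1 p.2 * Θ p.2 := hM.mul (hΘ.comp measurable_snd)
  refine ⟨(hJ.stronglyMeasurable.integral_prod_right' (ν := μ)).measurable, fun x => ?_⟩
  have h := norm_integral_le_of_norm_le_const (μ := μ) (f := fun y => M x y * Θ y) (C := CM * CΘ)
    (Filter.Eventually.of_forall fun y => by rw [Real.norm_eq_abs, abs_mul]; exact mul_le_mul (hMb x y) (hΘb y) (abs_nonneg _) ((abs_nonneg _).trans (hMb x y)))
  rw [Real.norm_eq_abs] at h
  linarith [h]

omit [NeZero L] in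
/-- ★ **The Rayleigh quotient is two-sided close to the model level**: `(1−σ)²λ·∫Θ²w ≤ ∫Θ·MΘ ≤ (1+σ)λ·∫Θ²w`. [folklore] -/
theorem rayleigh_two_sided (hM : Measurable (Function.uncurry M)) (hMb : ∀ x y, |M x y| ≤ CM) (hM0 : ∀ x y, 0 ≤ M x y)
    (hΘ : Measurable Θ) (hΘb : ∀ x, |Θ x| ≤ CΘ) (hΘ0 : ∀ x, 0 ≤ Θ x) (hΘS : ∀ x, x ∉ S → Θ x = 0) (hS : MeasurableSet S) (hI : MeasurableSet I) (hIS : I ⊆ S)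
    (hw : Measurable w) (hwb : ∀ x, |w x| ≤ Cw) (hw0 : ∀ x, 0 ≤ w x) (hlam : 0 < lam) (hσ1 : σ ≤ 1 / 4)
    (hQp : ∀ x ∈ S, ∫ y, M x y * Θ y ∂μ ≤ (1 + σ) * lam * (Θ x * w x)) (hQm : ∀ x ∈ I, (1 - σ) * lam * (Θ x * w x) ≤ ∫ y, M x y * Θ y ∂μ)
    (hring : ∫ x in S \ I, Θ x ^ 2 * w x ∂μ ≤ σ * ∫ x, Θ x ^ 2 * w x ∂μ) :
    (1 - σ) ^ 2 * lam * ∫ x, Θ x ^ 2 * w x ∂μ ≤ ∫ x, Θ x * ∫ y, M x y * Θ y ∂μ ∂μ ∧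
      ∫ x, Θ x * ∫ y, M x y * Θ y ∂μ ∂μ ≤ (1 + σ) * lam * ∫ x, Θ x ^ 2 * w x ∂μ := by
  obtain ⟨hPm, hPb⟩ := kernelProfile_props (μ := μ) hM hMb hΘ hΘb
  have hfm : Measurable fun x => Θ x ^ 2 * w x := (hΘ.pow_const 2).mul hw
  have hfi : Integrable (fun x => Θ x ^ 2 * w x) μ := integrable_of_measurable_abs_le μ hfm (C := CΘ ^ 2 * Cw) fun x => by
    rw [abs_mul, abs_pow]; exact mul_le_mul (pow_le_pow_left₀ (abs_nonneg _) (hΘb x) 2) (hwb x) (abs_nonneg _) (sq_nonneg _)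
  have hf0 : ∀ x, 0 ≤ Θ x ^ 2 * w x := fun x => mul_nonneg (sq_nonneg _) (hw0 x)
  have hgm : Measurable fun x => Θ x * ∫ y, M x y * Θ y ∂μ := hΘ.mul hPm
  have hgi : Integrable (fun x => Θ x * ∫ y, M x y * Θ y ∂μ) μ := integrable_of_measurable_abs_le μ hgm (C := CΘ * (CM * CΘ * μ.real Set.univ)) fun x => by
    rw [abs_mul]; exact mul_le_mul (hΘb x) (hPb x) (abs_nonneg _) ((abs_nonneg _).trans (hΘb x))
  have hP0 : ∀ x, 0 ≤ ∫ y, M x y * Θ y ∂μ := fun x => integral_nonneg fun y => mul_nonneg (hM0 x y) (hΘ0 y)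
  have hg0 : ∀ x, 0 ≤ Θ x * ∫ y, M x y * Θ y ∂μ := fun x => mul_nonneg (hΘ0 x) (hP0 x)
  -- everything lives on `S`
  have eS : ∫ x, Θ x * ∫ y, M x y * Θ y ∂μ ∂μ = ∫ x in S, Θ x * ∫ y, M x y * Θ y ∂μ ∂μ :=
    (setIntegral_eq_integral_of_forall_compl_eq_zero fun x hx => by rw [hΘS x hx, zero_mul]).symm
  have eS2 : ∫ x, Θ x ^ 2 * w x ∂μ = ∫ x in S, Θ x ^ 2 * w x ∂μ :=
    (setIntegral_eq_integral_of_forall_compl_eq_zero fun x hx => by rw [hΘS x hx]; ring).symm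
  constructor
  · -- lower: `∫_S Θ·MΘ ≥ ∫_I Θ·MΘ ≥ (1−σ)λ ∫_I Θ²w = (1−σ)λ(∫_S − ∫_{S∖I}) ≥ (1−σ)λ(1−σ)∫Θ²w`
    have h1 : ∫ x in I, Θ x * ∫ y, M x y * Θ y ∂μ ∂μ ≤ ∫ x in S, Θ x * ∫ y, M x y * Θ y ∂μ ∂μ :=
      setIntegral_mono_set hgi.integrableOn (ae_of_all _ hg0) (ae_of_all _ hIS)
    have h2 : ∫ x in I, (1 - σ) * lam * (Θ x ^ 2 * w x) ∂μ ≤ ∫ x in I, Θ x * ∫ y, M x y * Θ y ∂μ ∂μ :=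
      setIntegral_mono_on ((hfi.const_mul _).integrableOn) hgi.integrableOn hI fun x hx => by
        have := mul_le_mul_of_nonneg_left (hQm x hx) (hΘ0 x); nlinarith [this]
    have h3 : ∫ x in I, Θ x ^ 2 * w x ∂μ = (∫ x in S, Θ x ^ 2 * w x ∂μ) - ∫ x in S \ I, Θ x ^ 2 * w x ∂μ := by
      have hdisj : Disjoint I (S \ I) := Set.disjoint_sdiff_right
      have e : ∫ x in S, Θ x ^ 2 * w x ∂μ = ∫ x in I ∪ (S \ I), Θ x ^ 2 * w x ∂μ := by rw [Set.union_sdiff_self, Set.union_eq_self_of_subset_left hIS]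
      rw [e, setIntegral_union hdisj (hS.diff hI) hfi.integrableOn hfi.integrableOn]; ring
    rw [integral_const_mul] at h2
    rw [eS, eS2]
    have h4 : (1 - σ) ^ 2 * lam * ∫ x in S, Θ x ^ 2 * w x ∂μ ≤ (1 - σ) * lam * ∫ x in I, Θ x ^ 2 * w x ∂μ := by
      rw [h3, ← eS2]
      have hZ0 : 0 ≤ ∫ x, Θ x ^ 2 * w x ∂μ := integral_nonneg hf0
      have : (1 - σ) * lam * ((∫ x, Θ x ^ 2 * w x ∂μ) - ∫ x in S \ I, Θ x ^ 2 * w x ∂μ) ≥ (1 - σ) * lam * ((∫ x, Θ x ^ 2 * w x ∂μ) - σ * ∫ x, Θ x ^ 2 * w x ∂μ) :=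
        mul_le_mul_of_nonneg_left (by linarith) (mul_nonneg (by linarith) hlam.le)
      nlinarith [this, hZ0]
    linarith
  · -- upper: `∫_S Θ·MΘ ≤ (1+σ)λ ∫_S Θ²w`
    rw [eS, eS2]
    have h := setIntegral_mono_on hgi.integrableOn ((hfi.const_mul ((1 + σ) * lam)).integrableOn) hS fun x hx => by
      have := mul_le_mul_of_nonneg_left (hQp x hx) (hΘ0 x)
      show Θ x * ∫ y, M x y * Θ y ∂μ ≤ (1 + σ) * lam * (Θ x ^ 2 * w x)
      nlinarith [this]
    rwa [integral_const_mul] at h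

omit [NeZero L] in
/-- `D²/w ≤ c²·Θ²w` from `|D| ≤ c·Θw` (with the convention `a/0 = 0`). [folklore] -/
theorem sq_div_le_of_abs_le {D c θ ω : ℝ} (hω : 0 ≤ ω) (hc : 0 ≤ c) (hθ : 0 ≤ θ) (h : |D| ≤ c * (θ * ω)) : D ^ 2 / ω ≤ c ^ 2 * (θ ^ 2 * ω) := by
  rcases eq_or_lt_of_le hω with hω0 | hωpos
  · rw [← hω0, div_zero, mul_zero, mul_zero]
  · rw [div_le_iff₀ hωpos]
    have h2 : D ^ 2 ≤ (c * (θ * ω)) ^ 2 := by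
      have := abs_le_abs_of_nonneg (abs_nonneg D) h |>.trans (le_of_eq (abs_of_nonneg (by positivity)))
      calc D ^ 2 = |D| ^ 2 := (sq_abs D).symm
        _ ≤ (c * (θ * ω)) ^ 2 := pow_le_pow_left₀ (abs_nonneg _) h 2
    nlinarith [h2]

omit [NeZero L] in
/-- ★★ **hup + hdef FROM THE MODEL** (abstract): with `Λ = (∫Θ·MΘ)/(∫Θ²w)` and `∫Θ²w > 0`, under (Q±), (ring), `σ ≤ 1/4`:
`∀ x ∈ S, MΘ(x) ≤ ((1+σ)/(1−σ)²)·Λ·Θ(x)w(x)` and `∫_S (MΘ − ΛΘw)²/w ≤ ((9σ² + (1+σ)²σ)/(1−σ)⁴)·Λ²·∫Θ²w`. [folklore] -/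
theorem hup_hdef_of_model (hM : Measurable (Function.uncurry M)) (hMb : ∀ x y, |M x y| ≤ CM) (hM0 : ∀ x y, 0 ≤ M x y)
    (hΘ : Measurable Θ) (hΘb : ∀ x, |Θ x| ≤ CΘ) (hΘ0 : ∀ x, 0 ≤ Θ x) (hΘS : ∀ x, x ∉ S → Θ x = 0) (hS : MeasurableSet S) (hI : MeasurableSet I) (hIS : I ⊆ S)
    (hw : Measurable w) (hwb : ∀ x, |w x| ≤ Cw) (hw0 : ∀ x, 0 ≤ w x) (hZ : 0 < ∫ x, Θ x ^ 2 * w x ∂μ) (hlam : 0 < lam) (hσ0 : 0 ≤ σ) (hσ1 : σ ≤ 1 / 4)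
    (hQp : ∀ x ∈ S, ∫ y, M x y * Θ y ∂μ ≤ (1 + σ) * lam * (Θ x * w x)) (hQm : ∀ x ∈ I, (1 - σ) * lam * (Θ x * w x) ≤ ∫ y, M x y * Θ y ∂μ)
    (hring : ∫ x in S \ I, Θ x ^ 2 * w x ∂μ ≤ σ * ∫ x, Θ x ^ 2 * w x ∂μ) :
    (∀ x ∈ S, ∫ y, M x y * Θ y ∂μ ≤ (1 + σ) / (1 - σ) ^ 2 * ((∫ x, Θ x * ∫ y, M x y * Θ y ∂μ ∂μ) / ∫ x, Θ x ^ 2 * w x ∂μ) * (Θ x * w x)) ∧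
      ∫ x in S, ((∫ y, M x y * Θ y ∂μ) - (∫ x, Θ x * ∫ y, M x y * Θ y ∂μ ∂μ) / (∫ x, Θ x ^ 2 * w x ∂μ) * (Θ x * w x)) ^ 2 / w x ∂μ ≤
        (9 * σ ^ 2 + (1 + σ) ^ 2 * σ) / (1 - σ) ^ 4 * ((∫ x, Θ x * ∫ y, M x y * Θ y ∂μ ∂μ) / ∫ x, Θ x ^ 2 * w x ∂μ) ^ 2 * ∫ x, Θ x ^ 2 * w x ∂μ := by
  obtain ⟨hlo, hhi⟩ := rayleigh_two_sided (μ := μ) hM hMb hM0 hΘ hΘb hΘ0 hΘS hS hI hIS hw hwb hw0 hlam hσ1 hQp hQm hring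
  set Z := ∫ x, Θ x ^ 2 * w x ∂μ with hZdef
  set Nm := ∫ x, Θ x * ∫ y, M x y * Θ y ∂μ ∂μ with hNm
  set Λ := Nm / Z with hΛdef
  have h1σ : 0 < 1 - σ := by linarith
  have hΛlo : (1 - σ) ^ 2 * lam ≤ Λ := by rw [hΛdef, le_div_iff₀ hZ]; exact hlo
  have hΛhi : Λ ≤ (1 + σ) * lam := by rw [hΛdef, div_le_iff₀ hZ]; exact hhi
  have hΛ0 : 0 < Λ := lt_of_lt_of_le (by positivity) hΛlo
  have hlamΛ : lam ≤ Λ / (1 - σ) ^ 2 := by rw [le_div_iff₀ (by positivity)]; linarith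
  obtain ⟨hPm, hPb⟩ := kernelProfile_props (μ := μ) hM hMb hΘ hΘb
  have hP0 : ∀ x, 0 ≤ ∫ y, M x y * Θ y ∂μ := fun x => integral_nonneg fun y => mul_nonneg (hM0 x y) (hΘ0 y)
  have hfm : Measurable fun x => Θ x ^ 2 * w x := (hΘ.pow_const 2).mul hw
  have hfi : Integrable (fun x => Θ x ^ 2 * w x) μ := integrable_of_measurable_abs_le μ hfm (C := CΘ ^ 2 * Cw) fun x => by
    rw [abs_mul, abs_pow]; exact mul_le_mul (pow_le_pow_left₀ (abs_nonneg _) (hΘb x) 2) (hwb x) (abs_nonneg _) (sq_nonneg _)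
  have hf0 : ∀ x, 0 ≤ Θ x ^ 2 * w x := fun x => mul_nonneg (sq_nonneg _) (hw0 x)
  refine ⟨fun x hx => (hQp x hx).trans ?_, ?_⟩
  · have hΘw : 0 ≤ Θ x * w x := mul_nonneg (hΘ0 x) (hw0 x)
    have : (1 + σ) * lam ≤ (1 + σ) / (1 - σ) ^ 2 * Λ := by
      rw [div_mul_eq_mul_div, le_div_iff₀ (by positivity)]; nlinarith [hΛlo]
    exact mul_le_mul_of_nonneg_right this hΘw
  · -- pointwise defect bounds
    set Dfun : X → ℝ := fun x => (∫ y, M x y * Θ y ∂μ) - Λ * (Θ x * w x) with hDfun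
    have hin : ∀ x ∈ I, |Dfun x| ≤ 3 * σ * lam * (Θ x * w x) := fun x hx => by
      have hΘw : 0 ≤ Θ x * w x := mul_nonneg (hΘ0 x) (hw0 x)
      have hu := hQp x (hIS hx); have hl := hQm x hx
      rw [abs_le]; constructor <;> nlinarith [mul_le_mul_of_nonneg_right hΛlo hΘw, mul_le_mul_of_nonneg_right hΛhi hΘw, mul_nonneg hσ0 (mul_nonneg hlam.le hΘw),
        mul_nonneg (mul_nonneg hσ0 hσ0) (mul_nonneg hlam.le hΘw)]
    have hout : ∀ x ∈ S, |Dfun x| ≤ (1 + σ) * lam * (Θ x * w x) := fun x hx => by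
      have hΘw : 0 ≤ Θ x * w x := mul_nonneg (hΘ0 x) (hw0 x)
      have hu := hQp x hx
      rw [abs_le]; constructor <;> nlinarith [mul_le_mul_of_nonneg_right hΛhi hΘw, hP0 x, mul_nonneg hΛ0.le hΘw]
    have hpin : ∀ x ∈ I, Dfun x ^ 2 / w x ≤ (3 * σ * lam) ^ 2 * (Θ x ^ 2 * w x) := fun x hx =>
      sq_div_le_of_abs_le (hw0 x) (by positivity) (hΘ0 x) (hin x hx)
    have hpout : ∀ x ∈ S \ I, Dfun x ^ 2 / w x ≤ ((1 + σ) * lam) ^ 2 * (Θ x ^ 2 * w x) := fun x hx =>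
      sq_div_le_of_abs_le (hw0 x) (by positivity) (hΘ0 x) (hout x hx.1)
    -- integrability of `D²/w` on `S` via the bound on `S`
    have hDm : Measurable Dfun := hPm.sub ((hΘ.mul hw).const_mul Λ)
    have hqm : Measurable fun x => Dfun x ^ 2 / w x := (hDm.pow_const 2).div hw
    have hqb : ∀ x ∈ S, |Dfun x ^ 2 / w x| ≤ ((1 + σ) * lam) ^ 2 * (CΘ ^ 2 * Cw) := fun x hx => by
      rw [abs_of_nonneg (div_nonneg (sq_nonneg _) (hw0 x))]
      refine (sq_div_le_of_abs_le (hw0 x) (by positivity) (hΘ0 x) (hout x hx)).trans (mul_le_mul_of_nonneg_left ?_ (sq_nonneg _))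
      have h1 : Θ x ^ 2 ≤ CΘ ^ 2 := by rw [← sq_abs]; exact pow_le_pow_left₀ (abs_nonneg _) (hΘb x) 2
      exact mul_le_mul h1 ((le_abs_self _).trans (hwb x)) (hw0 x) (sq_nonneg _)
    have hqi : IntegrableOn (fun x => Dfun x ^ 2 / w x) S μ := by
      refine Integrable.mono' ((integrable_const (((1 + σ) * lam) ^ 2 * (CΘ ^ 2 * Cw))).restrict) hqm.aestronglyMeasurable.restrict ?_
      exact (ae_restrict_iff' hS).mpr (ae_of_all _ fun x hx => by rw [Real.norm_eq_abs]; exact hqb x hx)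
    -- split `S = I ∪ (S \ I)`
    have hdisj : Disjoint I (S \ I) := Set.disjoint_sdiff_right
    have eS : ∫ x in S, Dfun x ^ 2 / w x ∂μ = (∫ x in I, Dfun x ^ 2 / w x ∂μ) + ∫ x in S \ I, Dfun x ^ 2 / w x ∂μ := by
      have e : ∫ x in S, Dfun x ^ 2 / w x ∂μ = ∫ x in I ∪ (S \ I), Dfun x ^ 2 / w x ∂μ := by rw [Set.union_sdiff_self, Set.union_eq_self_of_subset_left hIS]
      rw [e, setIntegral_union hdisj (hS.diff hI) (hqi.mono_set hIS) (hqi.mono_set Set.sdiff_subset)]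
    have hI1 : ∫ x in I, Dfun x ^ 2 / w x ∂μ ≤ (3 * σ * lam) ^ 2 * ∫ x in I, Θ x ^ 2 * w x ∂μ := by
      rw [← integral_const_mul]
      exact setIntegral_mono_on (hqi.mono_set hIS) ((hfi.const_mul _).integrableOn) hI hpin
    have hI2 : ∫ x in S \ I, Dfun x ^ 2 / w x ∂μ ≤ ((1 + σ) * lam) ^ 2 * ∫ x in S \ I, Θ x ^ 2 * w x ∂μ := by
      rw [← integral_const_mul]
      exact setIntegral_mono_on (hqi.mono_set Set.sdiff_subset) ((hfi.const_mul _).integrableOn) (hS.diff hI) hpout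
    have hIZ : ∫ x in I, Θ x ^ 2 * w x ∂μ ≤ Z := setIntegral_le_integral hfi (ae_of_all _ hf0)
    have hlam2 : lam ^ 2 ≤ Λ ^ 2 / (1 - σ) ^ 4 := by
      have h := pow_le_pow_left₀ hlam.le hlamΛ 2
      rw [div_pow, ← pow_mul] at h; simpa using h
    show ∫ x in S, Dfun x ^ 2 / w x ∂μ ≤ (9 * σ ^ 2 + (1 + σ) ^ 2 * σ) / (1 - σ) ^ 4 * Λ ^ 2 * Z
    rw [eS]
    have hZ0 : 0 ≤ Z := hZ.le
    have hring' : ∫ x in S \ I, Θ x ^ 2 * w x ∂μ ≤ σ * Z := hring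
    have hr0 : 0 ≤ ∫ x in S \ I, Θ x ^ 2 * w x ∂μ := integral_nonneg fun x => hf0 x
    calc (∫ x in I, Dfun x ^ 2 / w x ∂μ) + ∫ x in S \ I, Dfun x ^ 2 / w x ∂μ
        ≤ (3 * σ * lam) ^ 2 * Z + ((1 + σ) * lam) ^ 2 * (σ * Z) :=
          add_le_add (hI1.trans (mul_le_mul_of_nonneg_left hIZ (sq_nonneg _))) (hI2.trans (mul_le_mul_of_nonneg_left hring' (sq_nonneg _)))
      _ = (9 * σ ^ 2 + (1 + σ) ^ 2 * σ) * lam ^ 2 * Z := by ring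
      _ ≤ (9 * σ ^ 2 + (1 + σ) ^ 2 * σ) * (Λ ^ 2 / (1 - σ) ^ 4) * Z :=
          mul_le_mul_of_nonneg_right (mul_le_mul_of_nonneg_left hlam2 (by positivity)) hZ0
      _ = (9 * σ ^ 2 + (1 + σ) ^ 2 * σ) / (1 - σ) ^ 4 * Λ ^ 2 * Z := by field_simp

end Frame


/-! ## §2 ★★★ spec (A) from the model atom, for the record objects -/

omit [NeZero L] in
/-- The two rate conversions: for `0 < σ ≤ min(1/8, η/8, η₂²/10)`, `(1+σ)/(1−σ)² ≤ 1+η` and `(9σ²+(1+σ)²σ)/(1−σ)⁴ ≤ η₂²`. [folklore] -/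
theorem quasimode_rates {σ η η₂ : ℝ} (hσ0 : 0 < σ) (hσ8 : σ ≤ 1 / 8) (hη : 0 < η) (hση : σ ≤ η / 8) (hση₂ : σ ≤ η₂ ^ 2 / 10) :
    (1 + σ) / (1 - σ) ^ 2 ≤ 1 + η ∧ (9 * σ ^ 2 + (1 + σ) ^ 2 * σ) / (1 - σ) ^ 4 ≤ η₂ ^ 2 := by
  have h1 : 0 < (1 - σ) ^ 2 := by nlinarith
  have h2 : 0 < (1 - σ) ^ 4 := by have : 0 < 1 - σ := by linarith
                                  positivity
  constructor
  · rw [div_le_iff₀ h1]; nlinarith [mul_pos hη hσ0]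
  · rw [div_le_iff₀ h2]
    have h3 : (9 : ℝ) / 16 ≤ (1 - σ) ^ 4 := by nlinarith [sq_nonneg (1 - σ), sq_nonneg σ]
    nlinarith [sq_nonneg σ, mul_pos hσ0 hσ0]

set_option maxHeartbeats 1600000 in
-- record-size statement.
/-- ★★★ **SPEC (A) FROM THE MODEL ATOM.**  If, for all large `M` and every `σ > 0`, eventually in `β` there are a level `λ > 0` and a measurable inner set `I ⊆ cS β` with
(Q+) `∫ cM(x,·)cΘ ≤ (1+σ)λ·cΘ(x)cW(x)` on `cS β`, (Q−) `(1−σ)λ·cΘ(x)cW(x) ≤ ∫ cM(x,·)cΘ` on `I`, (ring) `∫_{cS∖I} cΘ²cW ≤ σ∫cΘ²cW`, and `0 < ∫cΘ²cW`,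
then the conclusion of `spec_S3` holds. [cite: Luscher1983, §3] -/
theorem spec_S3_of_model {s : ℝ}
    (hmodel : ∃ M₀ : ℝ, 2 ≤ M₀ ∧ ∀ M : ℝ, M₀ ≤ M → ∀ σ : ℝ, 0 < σ → ∀ᶠ β : ℝ in atTop, ∃ (lam : ℝ) (I : Set (Edge 3 L → Fin 3 → ℝ)),
      0 < lam ∧ MeasurableSet I ∧ I ⊆ cS L β ∧ 0 < ∫ x, cΘ L β x ^ 2 * cW L s M β x ∂orthoTransverse L ∧
      (∀ x ∈ cS L β, ∫ y, cM L β x y * cΘ L β y ∂orthoTransverse L ≤ (1 + σ) * lam * (cΘ L β x * cW L s M β x)) ∧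
      (∀ x ∈ I, (1 - σ) * lam * (cΘ L β x * cW L s M β x) ≤ ∫ y, cM L β x y * cΘ L β y ∂orthoTransverse L) ∧
      ∫ x in cS L β \ I, cΘ L β x ^ 2 * cW L s M β x ∂orthoTransverse L ≤ σ * ∫ x, cΘ L β x ^ 2 * cW L s M β x ∂orthoTransverse L) :
    ∃ M₀ : ℝ, 2 ≤ M₀ ∧ ∀ M : ℝ, M₀ ≤ M → ∀ η : ℝ, 0 < η → ∀ η₂ : ℝ, 0 < η₂ → ∀ᶠ β : ℝ in atTop,
      (∀ x ∈ cS L β, ∫ y, cM L β x y * cΘ L β y ∂orthoTransverse L ≤ (1 + η) * cΛ L s M β * (cΘ L β x * cW L s M β x)) ∧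
      (∫ x in cS L β, ((∫ y, cM L β x y * cΘ L β y ∂orthoTransverse L) - cΛ L s M β * (cΘ L β x * cW L s M β x)) ^ 2 / cW L s M β x ∂orthoTransverse L ≤
        (η₂ * cΛ L s M β) ^ 2 * ∫ x, cΘ L β x ^ 2 * cW L s M β x ∂orthoTransverse L) := by
  haveI := isFiniteMeasure_orthoTransverse L
  obtain ⟨M₀, hM₀, H⟩ := hmodel
  refine ⟨M₀, hM₀, fun M hM η hη η₂ hη₂ => ?_⟩
  set σ : ℝ := min (1 / 8) (min (η / 8) (η₂ ^ 2 / 10)) with hσdef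
  have hσ0 : 0 < σ := lt_min (by norm_num) (lt_min (by positivity) (by positivity))
  have hσ8 : σ ≤ 1 / 8 := min_le_left _ _
  have hση : σ ≤ η / 8 := (min_le_right _ _).trans (min_le_left _ _)
  have hση₂ : σ ≤ η₂ ^ 2 / 10 := (min_le_right _ _).trans (min_le_right _ _)
  obtain ⟨hr1, hr2⟩ := quasimode_rates hσ0 hσ8 hη hση hση₂
  filter_upwards [H M hM σ hσ0, eventually_ge_atTop (0 : ℝ)] with β hβ hβ0
  obtain ⟨lam, I, hlam, hI, hIS, hZ, hQp, hQm, hring⟩ := hβ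
  obtain ⟨hMm, -, -, -, hΘm, hΘ1, hΘ0, hΘS, hSm⟩ := central_kform_data (L := L) hβ0
  obtain ⟨CM, hCM⟩ := cM_bounds (L := L) β
  obtain ⟨hwm, hwb, hw0⟩ := cW_props (L := L) s M β
  obtain ⟨hup, hdef⟩ := hup_hdef_of_model (μ := orthoTransverse L) hMm (fun x y => (hCM x y).2.2) (fun x y => (hCM x y).1) hΘm hΘ1 hΘ0 hΘS hSm hI hIS hwm hwb hw0 hZ
    hlam hσ0.le (by linarith) hQp hQm hring
  have eΛ : cΛ L s M β = (∫ x, cΘ L β x * ∫ y, cM L β x y * cΘ L β y ∂orthoTransverse L ∂orthoTransverse L) / ∫ x, cΘ L β x ^ 2 * cW L s M β x ∂orthoTransverse L := by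
    unfold cΛ; rw [cLambda_num_eq]
  have hΛ0 : 0 ≤ cΛ L s M β := by
    rw [eΛ]; exact div_nonneg (integral_nonneg fun x => mul_nonneg (hΘ0 x) (integral_nonneg fun y => mul_nonneg (hCM x y).1 (hΘ0 y))) hZ.le
  rw [← eΛ] at hup hdef
  refine ⟨fun x hx => (hup x hx).trans ?_, hdef.trans ?_⟩
  · exact mul_le_mul_of_nonneg_right (mul_le_mul_of_nonneg_right hr1 hΛ0) (mul_nonneg (hΘ0 x) (hw0 x))
  · rw [mul_pow]
    exact mul_le_mul_of_nonneg_right (mul_le_mul_of_nonneg_right hr2 (sq_nonneg _)) (integral_nonneg fun x => mul_nonneg (sq_nonneg _) (hw0 x))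

end Summit.QuantumFields.YangMills.Theorems.FemtoTransferGap.TwoLattice.ConstTube

end
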